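import Literature.Topology.FourManifolds.CodimTwoNormalEuler
import Mathlib.Topology.UnitInterval

/-!
# Discrete parallel transport of a nowhere-zero section through a family of idempotents
(registered helper `helper_transportSection` of the stub `stub_normalWitnessTransfer`, line
`cross-cap-laurent`, crux `GromovRecognitionRelEnd`, item stmt-SmoothPoincare4-11009)

Setting: a real normed space `F`, a compact pseudometric space `Y`, a jointly continuous family
`H y t` (`y ∈ Y`, `t ∈ [0, 1]`) of idempotents of `F`, and a continuous nowhere-zero initial
section `σ₀ : Y → F` with `σ₀ y` fixed by `H y 0`.  Claim (`helper_transportSection`): there is a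
continuous nowhere-zero `σ : Y → F` with `σ y` fixed by `H y 1` for every `y`.

Proof: verbatim the transport argument of
`Literature.Topology.FourManifolds.NormalEuler.exists_continuous_section` (the case of a constant
initial vector `v₀`), which is the elementary replacement, in R. C. Kirby's proof of
*The Topology of 4-Manifolds*, LNM 1374 (1989), Ch. VIII, Thm. 2, pp. 44–45, of "a bundle over a
contractible base is trivial": uniform continuity of `H` on the compact `Y × [0, 1]`
(`CompactSpace.uniformContinuous_of_continuous`, `Metric.uniformContinuous_iff`) gives `K` steps
`t_k = k / K` (`Set.projIcc`) with consecutive idempotents within operator-norm distance `1`;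
starting the recursion at `σ 0 := σ₀` (continuous by hypothesis, fixed by `H y 0 = H y t_0` by
hypothesis, nowhere zero by hypothesis), each step `σ (k+1) y := H y t_{k+1} (σ k y)` keeps the
vector nonzero (`NormalEuler.apply_ne_zero_of_norm_sub_lt`: if `‖P' - P‖ < 1` then `P'` kills no
nonzero vector fixed by `P`), fixed by the current idempotent `H y t_{k+1}` (idempotence), and
continuous in `y`; `σ K` (`t_K = 1`) is the required section.

Reference: R. C. Kirby, *The Topology of 4-Manifolds*, LNM 1374, Springer (1989), Ch. VIII,
Thm. 2, pp. 44–45 [Kirby1989].  No new definitions.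
-/

noncomputable section

open Set Function Metric
open scoped Topology

-- the prescribed namespace `Summit.<P>.<Sub>.…` duplicates `SmoothPoincare4` (P = Sub)
set_option linter.dupNamespace false

namespace Summit.SmoothPoincare4.SmoothPoincare4.Theorems.GromovRecognitionRelEnd.CrossCapLaurent

open Literature.Topology.FourManifolds.NormalEuler in
/-- **Registered helper `helper_transportSection`: discrete parallel transport of a section.**
Let `H y t` (`y` in a compact pseudometric space `Y`, `t ∈ [0, 1]`) be a jointly continuous
family of idempotents of a real normed space `F`, and let `σ₀ : Y → F` be continuous, nowhere
zero, with `σ₀ y` fixed by `H y 0`. Then there is a continuous nowhere-zero `σ : Y → F` with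
`σ y` fixed by `H y 1`: transport `σ₀ y` along `t` in `K` steps `v ↦ H y t_{k+1} v`, where `K` is
so large that consecutive idempotents are within operator-norm distance `1` (uniform continuity
on the compact `Y × [0, 1]`), so that no step kills a vector (`apply_ne_zero_of_norm_sub_lt`);
continuity in `y` and fixedness are carried along the induction. This is the proof of
`NormalEuler.exists_continuous_section` started at the section `σ₀` instead of a constant vector.
[cite: Kirby1989, Ch. VIII, Thm. 2, pp. 44–45] -/
theorem helper_transportSection : ∀ (F : Type) [NormedAddCommGroup F] [NormedSpace ℝ F] (Y : Type) [PseudoMetricSpace Y] [CompactSpace Y] (H : Y → unitInterval → F →L[ℝ] F) (σ₀ : Y → F), Continuous (fun p : Y × unitInterval => H p.1 p.2) → (∀ y t v, H y t (H y t v) = H y t v) → Continuous σ₀ → (∀ y, H y 0 (σ₀ y) = σ₀ y) → (∀ y, σ₀ y ≠ 0) → ∃ σ : Y → F, Continuous σ ∧ ∀ y, H y 1 (σ y) = σ y ∧ σ y ≠ 0 := by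
  intro F _ _ Y _ _ H σ₀ hH hidem hσ₀ h0 hne
  -- uniform continuity: a modulus for operator-norm distance `1`
  have hU : UniformContinuous fun p : Y × unitInterval => H p.1 p.2 :=
    CompactSpace.uniformContinuous_of_continuous hH
  obtain ⟨δ, hδ, hδU⟩ := Metric.uniformContinuous_iff.1 hU 1 one_pos
  obtain ⟨N, hN⟩ := exists_nat_one_div_lt hδ
  set K : ℕ := N + 1 with hK
  have hKpos : (0 : ℝ) < K := by positivity
  -- the subdivision `t_k = k / K`
  let tk : ℕ → unitInterval := fun k => Set.projIcc (0 : ℝ) 1 zero_le_one (k / K)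
  have htk : ∀ k, k ≤ K → ((tk k : unitInterval) : ℝ) = k / K := by
    intro k hk
    have hmem : (k : ℝ) / K ∈ Icc (0 : ℝ) 1 :=
      ⟨by positivity, div_le_one_of_le₀ (by exact_mod_cast hk) hKpos.le⟩
    simp only [tk, Set.projIcc_of_mem _ hmem]
  have htk0 : tk 0 = 0 := by
    simp only [tk, Nat.cast_zero, zero_div, Set.projIcc_left, Set.Icc.mk_zero]
  have htkK : tk K = 1 := by
    simp only [tk, div_self hKpos.ne', Set.projIcc_right, Set.Icc.mk_one]
  have hclose : ∀ k, k + 1 ≤ K → ∀ y, ‖H y (tk (k + 1)) - H y (tk k)‖ < 1 := by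
    intro k hk y
    have hd : dist ((y, tk (k + 1)) : Y × unitInterval) (y, tk k) < δ := by
      rw [Prod.dist_eq, dist_self, max_eq_right dist_nonneg, Subtype.dist_eq, htk _ hk,
        htk _ (Nat.le_of_succ_le hk), Real.dist_eq, Nat.cast_succ, add_div, add_sub_cancel_left,
        abs_of_pos (by positivity)]
      calc (1 : ℝ) / K = 1 / ((N : ℝ) + 1) := by rw [hK, Nat.cast_succ]
        _ < δ := hN
    have := hδU hd
    rwa [dist_eq_norm] at this
  -- the transported sections, starting at `σ₀`
  let σ : ℕ → Y → F := fun k => Nat.rec σ₀ (fun k σk y => H y (tk (k + 1)) (σk y)) k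
  have hσ0 : σ 0 = σ₀ := rfl
  have hσs : ∀ k, σ (k + 1) = fun y => H y (tk (k + 1)) (σ k y) := fun k => rfl
  have hHc : ∀ t, Continuous fun y => H y t := fun t =>
    hH.comp (continuous_id.prodMk continuous_const)
  have key : ∀ k, k ≤ K → Continuous (σ k) ∧ ∀ y, H y (tk k) (σ k y) = σ k y ∧ σ k y ≠ 0 := by
    intro k
    induction k with
    | zero =>
      intro _
      refine ⟨by rw [hσ0]; exact hσ₀, fun y => ⟨?_, by rw [hσ0]; exact hne y⟩⟩
      rw [hσ0, htk0]
      exact h0 y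
    | succ k ih =>
      intro hk
      obtain ⟨hc, hfix⟩ := ih (Nat.le_of_succ_le hk)
      refine ⟨?_, fun y => ⟨?_, ?_⟩⟩
      · rw [hσs]
        exact (hHc _).clm_apply hc
      · rw [hσs]
        exact hidem y _ _
      · rw [hσs]
        exact apply_ne_zero_of_norm_sub_lt (hfix y).1 (hfix y).2 (hclose k hk y)
  obtain ⟨hc, hfix⟩ := key K le_rfl
  refine ⟨σ K, hc, fun y => ?_⟩
  have := hfix y
  rwa [htkK] at this

end Summit.SmoothPoincare4.SmoothPoincare4.Theorems.GromovRecognitionRelEnd.CrossCapLaurent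

end
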